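import Summits.BirchSwinnertonDyer.BirchSwinnertonDyer.Theses.KolyvaginRankRigidityAtTwo
import Summits.BirchSwinnertonDyer.BirchSwinnertonDyer.Theorems.KolyvaginRankRigidityAtTwoKolyvaginNonvanishingAtTwoFrameNonTorsionLevelOne
import HarnessLib

/-!
# LINE skeleton for crux V1′ `KolyvaginNonvanishingAtTwoFrame` (stmt-BirchSwinnertonDyer-24622),
# route `KolyvaginRankRigidityAtTwo` — line `level_one_split` (the planner's registered BC3 birth split)

V1′ is Kolyvagin's conjecture AT `p = 2` on the surjective-2-adic habitat, universal frame
(`Dt, β, ι`): some Kolyvagin class `c_M(n) ≠ 0` (`n` Kolyvagin-square-free at `2`, `1 ≤ M ≤ M(n)`).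
The registered line splits at LEVEL ONE on the order of `P(1) = Tr_{K[1]/K} y(1) = y_K`:

* `stub_nonTorsionLevelOne` — **LANDED p607844** (`KolyvaginAtTwo.stub_nonTorsionLevelOne`,
  imported): some conductor-`1` datum with `P(1)` of infinite order ⇒ `c_M(1) ≠ 0` at the level
  `M ≥ 1` with `2^M ∤ P(1)` in `E(K[1])` (Mordell–Weil over `K[1]`, admissibility at `2` on the
  habitat, `Γ_K`-invariance of `P(1)`, McCallum Cor. 4.5).
* `stub_torsionLevelOne` — **the research content** (every `P(1)` torsion, i.e. `y_K` torsion, i.e.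
  `ord_{s=1} L(E/K, s) ≥ 3` under Gross–Zagier ⇒ a non-zero class of positive depth): Kolyvagin's
  conjecture proper at `p = 2` (printed only for `p` odd: W. Zhang 2014 Thm. 1.1 `p ≥ 5`, BCGS 2026
  Thm. 1 `p > 3`).

Glue `KolyvaginNonvanishingAtTwoFrame_of`: excluded middle on `∃ d₁, ¬ IsOfFinAddOrder d₁.derivedPoint`.
HONEST FRAMING: V1′ is not proved while `stub_torsionLevelOne` is `sorry`; BSD is not proved by this.
-/

set_option autoImplicit false
-- the Theorems namespace of this sub repeats the summit name by design (D-0017 nested layout)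
set_option linter.dupNamespace false

noncomputable section

open scoped Classical

open WeierstrassCurve Literature.NumberTheory.EllipticCurves
  Literature.NumberTheory.EllipticCurves.ModularForms
open Summit.BirchSwinnertonDyer.BirchSwinnertonDyer.Theses.KolyvaginRankRigidityAtTwo

namespace Summit.BirchSwinnertonDyer.BirchSwinnertonDyer.Theorems.KolyvaginAtTwo

/-! ## Stub 1 — `P(1)` of infinite order: LANDED (p607844), `KolyvaginAtTwo.stub_nonTorsionLevelOne`. -/

/-! ## Stub 2 — every `P(1)` torsion (Kolyvagin's conjecture at `2`, positive depth) -/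

/-- **`stub_torsionLevelOne`** (registered on stmt-BirchSwinnertonDyer-24622): on V1′'s habitat and
frame, if EVERY conductor-`1` datum has `P(1)` torsion, some Kolyvagin class of the frame is non-zero
(necessarily of positive depth). Kolyvagin's conjecture at `p = 2`; research content of the line.
[cite: WZhang2014, Thm. 1.1 (p ≥ 5)] [cite: Kolyvagin1991MathAnn, Conj. 1.1] -/
theorem stub_torsionLevelOne :
    ∀ (W : WeierstrassCurve ℚ) [W.IsElliptic] [W.IsGloballyMinimal], ¬ W.HasCM →
      (Literature.NumberTheory.EllipticCurves.Rank1Residual.GoodOrd W 2 ∨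
      Literature.NumberTheory.EllipticCurves.Rank1Residual.Mult W 2) → (∀ m : ℕ,
      W.HasSurjectiveModNGaloisRep (2 ^ m : ℕ)) → ∀ (K : Type) [Field K] [NumberField K],
      Literature.NumberTheory.EllipticCurves.IsImaginaryQuadratic K → ∀ [NeZero (W.conductorNorm
      ℤ)], Literature.NumberTheory.EllipticCurves.SatisfiesHeegnerHypothesis (W.conductorNorm ℤ) K →
      Odd (NumberField.discr K) → NumberField.discr K ≠ -3 → AddSubgroup.torsionBy (W.baseChange
      K).toAffine.Point (2 : ℤ) = ⊥ →
      Literature.NumberTheory.EllipticCurves.SatisfiesHeegnerHypothesis 2 K → ∀ (Dt :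
      Literature.NumberTheory.EllipticCurves.ModularForms.ModularParametrizationData W
      (W.conductorNorm ℤ)) (β : ℤ) (ι : K →+* ℂ), (4 * (W.conductorNorm ℤ : ℤ)) ∣ β ^ 2 -
      NumberField.discr K → (∀ d₁ : Literature.NumberTheory.EllipticCurves.KolyvaginHeegnerData Dt β
      ι 1, IsOfFinAddOrder d₁.derivedPoint) → ∃ (n : ℕ) (d :
      Literature.NumberTheory.EllipticCurves.KolyvaginHeegnerData Dt β ι n) (M : ℕ),
      Literature.NumberTheory.EllipticCurves.KolyvaginDescent.KolSupp
      (Literature.NumberTheory.EllipticCurves.Zhang2014.IsKolyvaginPrime (W.conductorNorm ℤ) W K 2)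
      n ∧ 1 ≤ M ∧ (M : ℕ∞) ≤ Literature.NumberTheory.EllipticCurves.Zhang2014.levelIndex W 2 n ∧
      d.kolyvaginClass Nat.prime_two M ≠ 0 := by
  sorry

/-! ## Glue -/

/-- **V1′ from the two level-one stubs** (excluded middle on the order of `P(1)`); no hypothesis
beyond the item's own statement, so closing `stub_torsionLevelOne` closes the crux by name. -/
theorem KolyvaginNonvanishingAtTwoFrame_of : KolyvaginNonvanishingAtTwoFrame := by
  intro W _ _ hCM hred hsur K _ _ hK _ hHN hodd hne3 htor hH2 Dt β ι hβ
  by_cases h : ∃ d₁ : KolyvaginHeegnerData Dt β ι 1, ¬ IsOfFinAddOrder d₁.derivedPoint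
  · exact stub_nonTorsionLevelOne W hCM hred hsur K hK hHN hodd hne3 htor hH2 Dt β ι hβ h
  · push Not at h
    exact stub_torsionLevelOne W hCM hred hsur K hK hHN hodd hne3 htor hH2 Dt β ι hβ h

end Summit.BirchSwinnertonDyer.BirchSwinnertonDyer.Theorems.KolyvaginAtTwo

end
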